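import Mathlib
import HarnessLib
import Summits.Ventures.LatticeQCDFlow.Scaling.U1ConvolutionPowerPeak

/-!
# LatticeQCDFlow / Scaling — `U(1)`: the convolution-power moments `A_i = (K_wⁱ w)(1)` are LOG-CONVEX
# at EVERY step (the even steps need positive-definiteness of the Wilson weight)

HONEST FRAMING: exact (Metropolis-corrected) sampling algorithms for lattice gauge theory;
figures of merit are autocorrelation/cost numbers at stated couplings and volumes; no
continuum-physics claim.

Venture `LatticeQCDFlow` (cell pub-lqcd), topic `Scaling`, FANOUT row 30 (lean-1, GEN-17) — OUR WORK,
sequel of `Scaling/U1ConvolutionPowerPeak`.  `Scaling/HaarConvolutionRatio.iterate_sq_le` gives, for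
every compact group and symmetric weight, log-convexity of `A_i := (K_wⁱ w)(1)` in steps of TWO
(Cauchy–Schwarz), which is why the explicit 2-d `U(1)` tunnelling law (`Scaling/FluxTunnellingU1Explicit`
and sequels) carries the hypothesis `L` even.  For `U(1)` and `w_β = e^{−β(1 − Re)}`, `β ≥ 0`:

* §1 **`vonMises_form_cauchySchwarz`** — for bounded measurable NON-NEGATIVE `f, h` with positive
  means, `B(f,h)² ≤ B(f,f)·B(h,h)` for the von Mises form `B(f,h) = ∫∫ f(a)h(c)e^{β Re(a⁻¹c)}`
  (from `vonMises_form_le_half_add` by the scaling `λ² = B(f,h)/B(f,f)`; `B(f,f) ≥ (∫f)² > 0` from the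
  series `hasSum_vonMises_form`).
* §2 `lintegral_haarConv_mul_eq_form` — `∫ (K_w φ)·ψ dHaar = e^{−β}·B(ψ, φ)` (real form) for measurable
  `φ, ψ ≤ 1`; **`u1_iterate_logConvex_odd`** (`A_{2j+2}² ≤ A_{2j+1}A_{2j+3}`, plain Cauchy–Schwarz in
  `L²(Haar)`, any compact group in fact) and **`u1_iterate_logConvex_even`**
  (`A_{2j+3}² ≤ A_{2j+2}A_{2j+4}`, Cauchy–Schwarz for the positive semi-definite form `⟨φ, K_w ψ⟩`);
  together **`u1_iterate_logConvex`**: `A_{i+2}² ≤ A_{i+1}·A_{i+3}` for every `i` (all consecutive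
  triples from the first index on).

READING (value-free): with log-convexity at every step the moment-ratio chain of
`HaarConvolutionRatio` runs through all indices; the parity restriction `L` even of the explicit
`U(1)` tunnelling files is an artefact (its removal is not done here).  NOT CLAIMED: non-abelian groups;
`β < 0`; any number of ours.  Elementary over the parent; no `def`; nothing is cited as a fact; no
`sorry`.
-/

noncomputable section

namespace Summit.Ventures.LatticeQCDFlow.Theory2.HaarConv

open MeasureTheory Real
open Literature.MathematicalPhysics.QuantumFieldTheory Literature.MathematicalPhysics.QuantumLattice
open Summit.Ventures.LatticeQCDFlow.Theory2.Lattice.TwoDim (measurable_circle_re abs_circle_re_le_one)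
open scoped ENNReal

variable {β : ℝ}

/-! ## §1 Cauchy–Schwarz for the von Mises form -/

/-- Scaling both arguments of the von Mises form. [ours] -/
theorem vonMises_form_smul (f h : Circle → ℝ) (c d : ℝ) :
    ∫ p : Circle × Circle, (c * f p.1) * (d * h p.2) * Real.exp (β * ((p.1⁻¹ * p.2 : Circle) : ℂ).re)
        ∂((haarProbability Circle).prod (haarProbability Circle)) =
      (c * d) * ∫ p : Circle × Circle, f p.1 * h p.2 * Real.exp (β * ((p.1⁻¹ * p.2 : Circle) : ℂ).re)
        ∂((haarProbability Circle).prod (haarProbability Circle)) := by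
  rw [← integral_const_mul]
  refine integral_congr_ae (ae_of_all _ fun p => ?_)
  ring

/-- **The von Mises form dominates the square of the mean**: `(∫ f)² ≤ B(f,f)` for `β ≥ 0` (the
`(0,0)` term of `hasSum_vonMises_form`; all terms are non-negative). [ours] -/
theorem sq_integral_le_vonMises_form (hβ : 0 ≤ β) (f : Circle → ℝ) (hfm : Measurable f) {Cf : ℝ}
    (hfb : ∀ a, |f a| ≤ Cf) :
    (∫ a, f a ∂(haarProbability Circle)) ^ 2 ≤
      ∫ p : Circle × Circle, f p.1 * f p.2 * Real.exp (β * ((p.1⁻¹ * p.2 : Circle) : ℂ).re)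
        ∂((haarProbability Circle).prod (haarProbability Circle)) := by
  have H := hasSum_vonMises_form f f hfm hfm hfb hfb (β := β)
  have hnn : ∀ nm : ℕ × ℕ, nm ≠ (0, 0) → 0 ≤ (β ^ nm.1 / nm.1.factorial * (β ^ nm.2 / nm.2.factorial)) *
      ((∫ a, f a * ((a : ℂ).re ^ nm.1 * (a : ℂ).im ^ nm.2) ∂(haarProbability Circle)) *
        ∫ c, f c * ((c : ℂ).re ^ nm.1 * (c : ℂ).im ^ nm.2) ∂(haarProbability Circle)) := fun nm _ =>
    mul_nonneg (by positivity) (mul_self_nonneg _)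
  have h := le_hasSum H (0, 0) hnn
  simpa [pow_two] using h

/-- **CAUCHY–SCHWARZ FOR THE VON MISES FORM** (non-negative bounded measurable `f, h` with positive
means, `β ≥ 0`): `B(f,h)² ≤ B(f,f)·B(h,h)`. [ours] -/
theorem vonMises_form_cauchySchwarz (hβ : 0 ≤ β) (f h : Circle → ℝ) (hfm : Measurable f)
    (hhm : Measurable h) (hf0 : ∀ a, 0 ≤ f a) (hh0 : ∀ c, 0 ≤ h c) {Cf Ch : ℝ} (hfb : ∀ a, |f a| ≤ Cf)
    (hhb : ∀ c, |h c| ≤ Ch) (hfpos : 0 < ∫ a, f a ∂(haarProbability Circle)) :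
    (∫ p : Circle × Circle, f p.1 * h p.2 * Real.exp (β * ((p.1⁻¹ * p.2 : Circle) : ℂ).re)
        ∂((haarProbability Circle).prod (haarProbability Circle))) ^ 2 ≤
      (∫ p : Circle × Circle, f p.1 * f p.2 * Real.exp (β * ((p.1⁻¹ * p.2 : Circle) : ℂ).re)
          ∂((haarProbability Circle).prod (haarProbability Circle))) *
        ∫ p : Circle × Circle, h p.1 * h p.2 * Real.exp (β * ((p.1⁻¹ * p.2 : Circle) : ℂ).re)
          ∂((haarProbability Circle).prod (haarProbability Circle)) := by
  set μ := haarProbability Circle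
  set Bfh := ∫ p : Circle × Circle, f p.1 * h p.2 * Real.exp (β * ((p.1⁻¹ * p.2 : Circle) : ℂ).re)
    ∂(μ.prod μ) with hBfh
  set P := ∫ p : Circle × Circle, f p.1 * f p.2 * Real.exp (β * ((p.1⁻¹ * p.2 : Circle) : ℂ).re)
    ∂(μ.prod μ) with hP
  set Q := ∫ p : Circle × Circle, h p.1 * h p.2 * Real.exp (β * ((p.1⁻¹ * p.2 : Circle) : ℂ).re)
    ∂(μ.prod μ) with hQ
  have hPpos : 0 < P := lt_of_lt_of_le (pow_pos hfpos 2) (sq_integral_le_vonMises_form hβ f hfm hfb)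
  have hB0 : 0 ≤ Bfh := integral_nonneg fun p =>
    mul_nonneg (mul_nonneg (hf0 _) (hh0 _)) (Real.exp_pos _).le
  have hQ0 : 0 ≤ Q := integral_nonneg fun p => mul_nonneg (mul_nonneg (hh0 _) (hh0 _)) (Real.exp_pos _).le
  rcases eq_or_lt_of_le hB0 with hB | hB
  · rw [← hB]; simpa using mul_nonneg hPpos.le hQ0
  -- scaling `λ = √(B/P)`: `B ≤ (B + PQ/B)/2`
  set l : ℝ := Real.sqrt (Bfh / P) with hl
  have hl2 : l * l = Bfh / P := Real.mul_self_sqrt (div_pos hB hPpos).le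
  have hlpos : 0 < l := Real.sqrt_pos.2 (div_pos hB hPpos)
  have hlfm : Measurable fun a => l * f a := hfm.const_mul l
  have hlhm : Measurable fun c => l⁻¹ * h c := hhm.const_mul l⁻¹
  have hlfb : ∀ a, |l * f a| ≤ |l| * Cf := fun a => by
    rw [abs_mul]; exact mul_le_mul_of_nonneg_left (hfb a) (abs_nonneg _)
  have hlhb : ∀ c, |l⁻¹ * h c| ≤ |l⁻¹| * Ch := fun c => by
    rw [abs_mul]; exact mul_le_mul_of_nonneg_left (hhb c) (abs_nonneg _)
  have hle := vonMises_form_le_half_add (fun a => l * f a) (fun c => l⁻¹ * h c) hβ hlfm hlhm hlfb hlhb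
  rw [vonMises_form_smul f h l l⁻¹, vonMises_form_smul f f l l, vonMises_form_smul h h l⁻¹ l⁻¹,
    mul_inv_cancel₀ hlpos.ne', one_mul] at hle
  -- `hle : B ≤ (l² P + l⁻² Q)/2 = (B + PQ/B)/2`
  have h1 : l * l * P = Bfh := by rw [hl2, div_mul_cancel₀ _ hPpos.ne']
  have h2 : l⁻¹ * l⁻¹ * Q = P * Q / Bfh := by
    rw [← mul_inv, hl2, inv_div]; field_simp
  rw [h1, h2] at hle
  -- `B ≤ (B + PQ/B)/2` ⇒ `B² ≤ PQ`
  have h3 : Bfh ≤ P * Q / Bfh := by linarith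
  rw [le_div_iff₀ hB] at h3
  nlinarith [h3]

/-! ## §2 Log-convexity of the convolution-power moments -/

/-- `∫ (K_w φ)·ψ dHaar = e^{−β}·B(ψ, φ)` in real form, for measurable `φ, ψ ≤ 1` (`w = w_β`). [ours] -/
theorem lintegral_haarConv_mul_eq_form (β : ℝ) {φ ψ : Circle → ℝ≥0∞} (hφm : Measurable φ)
    (hψm : Measurable ψ) (hφ1 : ∀ v, φ v ≤ 1) (hψ1 : ∀ v, ψ v ≤ 1) :
    ∫⁻ v, haarConv (u1W β) φ v * ψ v ∂(haarProbability Circle) =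
      ENNReal.ofReal (Real.exp (-β) *
        ∫ p : Circle × Circle, (ψ p.1).toReal * (φ p.2).toReal *
          Real.exp (β * ((p.1⁻¹ * p.2 : Circle) : ℂ).re)
          ∂((haarProbability Circle).prod (haarProbability Circle))) := by
  set μ := haarProbability Circle
  have hφT : ∀ v, φ v ≠ ⊤ := fun v => ne_top_of_le_ne_top ENNReal.one_ne_top (hφ1 v)
  have hψT : ∀ v, ψ v ≠ ⊤ := fun v => ne_top_of_le_ne_top ENNReal.one_ne_top (hψ1 v)
  have hφR1 : ∀ v, (φ v).toReal ≤ 1 := fun v =>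
    ENNReal.toReal_le_of_le_ofReal zero_le_one (by simpa using hφ1 v)
  have hψR1 : ∀ v, (ψ v).toReal ≤ 1 := fun v =>
    ENNReal.toReal_le_of_le_ofReal zero_le_one (by simpa using hψ1 v)
  let Gf : Circle × Circle → ℝ := fun p => (ψ p.1).toReal * (φ p.2).toReal *
    (Real.exp (-β) * Real.exp (β * ((p.1⁻¹ * p.2 : Circle) : ℂ).re))
  have hre : Measurable fun p : Circle × Circle => ((p.1⁻¹ * p.2 : Circle) : ℂ).re :=
    measurable_circle_re.comp (measurable_fst.inv.mul measurable_snd)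
  have hGm : Measurable Gf :=
    ((hψm.ennreal_toReal.comp measurable_fst).mul (hφm.ennreal_toReal.comp measurable_snd)).mul
      (measurable_const.mul (Real.measurable_exp.comp (hre.const_mul β)))
  have hGnn : ∀ p, 0 ≤ Gf p := fun p =>
    mul_nonneg (mul_nonneg ENNReal.toReal_nonneg ENNReal.toReal_nonneg)
      (mul_nonneg (Real.exp_pos _).le (Real.exp_pos _).le)
  have hGb : ∀ p, ‖Gf p‖ ≤ 1 * 1 * (Real.exp (-β) * Real.exp |β|) := by
    intro p
    rw [Real.norm_eq_abs, abs_of_nonneg (hGnn p)]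
    have h3 : Real.exp (β * ((p.1⁻¹ * p.2 : Circle) : ℂ).re) ≤ Real.exp |β| := by
      refine Real.exp_le_exp.2 ((le_abs_self _).trans ?_)
      rw [abs_mul]
      exact (mul_le_mul_of_nonneg_left (abs_circle_re_le_one (p.1⁻¹ * p.2)) (abs_nonneg _)).trans
        (by rw [mul_one])
    exact mul_le_mul (mul_le_mul (hψR1 _) (hφR1 _) ENNReal.toReal_nonneg zero_le_one)
      (mul_le_mul_of_nonneg_left h3 (Real.exp_pos _).le)
      (mul_nonneg (Real.exp_pos _).le (Real.exp_pos _).le) (by norm_num)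
  have hGi : Integrable Gf (μ.prod μ) :=
    Integrable.mono' (integrable_const _) hGm.aestronglyMeasurable (ae_of_all _ hGb)
  have hpt : ∀ v c, φ c * u1W β (v⁻¹ * c) * ψ v = ENNReal.ofReal (Gf (v, c)) := by
    intro v c
    have hwv : u1W β (v⁻¹ * c) =
        ENNReal.ofReal (Real.exp (-β) * Real.exp (β * ((v⁻¹ * c : Circle) : ℂ).re)) := by
      rw [u1W_apply, ← Real.exp_add]; congr 1; ring
    rw [← ENNReal.ofReal_toReal (hφT c), ← ENNReal.ofReal_toReal (hψT v), hwv,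
      ← ENNReal.ofReal_mul ENNReal.toReal_nonneg,
      ← ENNReal.ofReal_mul (mul_nonneg ENNReal.toReal_nonneg
        (mul_nonneg (Real.exp_pos _).le (Real.exp_pos _).le))]
    congr 1
    simp only [Gf]
    ring
  have hinner : ∀ v, haarConv (u1W β) φ v * ψ v = ∫⁻ c, ENNReal.ofReal (Gf (v, c)) ∂μ := by
    intro v
    rw [haarConv_eq_lintegral_mul_inv, ← lintegral_mul_const _
      (f := fun c => φ c * u1W β (v⁻¹ * c)) (hφm.mul ((measurable_u1W β).comp (measurable_const_mul v⁻¹)))]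
    exact lintegral_congr fun c => hpt v c
  rw [lintegral_congr hinner,
    lintegral_lintegral (f := fun v c => ENNReal.ofReal (Gf (v, c))) hGm.ennreal_ofReal.aemeasurable,
    ← ofReal_integral_eq_lintegral_ofReal hGi (ae_of_all _ hGnn), ← integral_const_mul]
  congr 1
  refine integral_congr_ae (ae_of_all _ fun p => ?_)
  simp only [Gf]
  ring

/-- **LOG-CONVEXITY AT ODD STEPS** (plain Cauchy–Schwarz in `L²(Haar)`): `A_{2j+2}² ≤ A_{2j+1}·A_{2j+3}`
with `A_i = (K_wⁱ w)(1)`, `w = w_β`. [ours] -/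
theorem u1_iterate_logConvex_odd (β : ℝ) (j : ℕ) :
    ((haarConv (u1W β))^[2 * j + 2] (u1W β) 1) ^ 2 ≤
      (haarConv (u1W β))^[2 * j + 1] (u1W β) 1 * (haarConv (u1W β))^[2 * j + 3] (u1W β) 1 := by
  have hw : Measurable (u1W β) := measurable_u1W β
  have hws := u1W_symm β
  have hK : ∀ m, Measurable ((haarConv (u1W β))^[m] (u1W β)) := measurable_iterate hw hw
  rw [show 2 * j + 2 = (j + (j + 1)) + 1 by ring, iterate_succ_apply_one, Function.iterate_add_apply,
    lintegral_iterate_mul hw hws (hK _) hw j, ← lintegral_iterate_sq hw hws j,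
    show 2 * j + 3 = 2 * (j + 1) + 1 by ring, ← lintegral_iterate_sq hw hws (j + 1)]
  calc (∫⁻ v, (haarConv (u1W β))^[j + 1] (u1W β) v * (haarConv (u1W β))^[j] (u1W β) v
        ∂(haarProbability Circle)) ^ 2
      ≤ (∫⁻ v, ((haarConv (u1W β))^[j + 1] (u1W β) v) ^ 2 ∂(haarProbability Circle)) *
          ∫⁻ v, ((haarConv (u1W β))^[j] (u1W β) v) ^ 2 ∂(haarProbability Circle) :=
        lintegral_mul_sq_le _ (hK _).aemeasurable (hK _).aemeasurable
    _ = _ := mul_comm _ _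

/-- **LOG-CONVEXITY AT EVEN STEPS** (Cauchy–Schwarz for the positive semi-definite form
`⟨φ, K_w ψ⟩`, i.e. positive-definiteness of `w_β`, `β ≥ 0`): `A_{2j+3}² ≤ A_{2j+2}·A_{2j+4}`. [ours] -/
theorem u1_iterate_logConvex_even (hβ : 0 ≤ β) (j : ℕ) :
    ((haarConv (u1W β))^[2 * j + 3] (u1W β) 1) ^ 2 ≤
      (haarConv (u1W β))^[2 * j + 2] (u1W β) 1 * (haarConv (u1W β))^[2 * j + 4] (u1W β) 1 := by
  set μ := haarProbability Circle
  have hw : Measurable (u1W β) := measurable_u1W β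
  have hws := u1W_symm β
  have hK : ∀ m, Measurable ((haarConv (u1W β))^[m] (u1W β)) := measurable_iterate hw hw
  have hK1 : ∀ m v, (haarConv (u1W β))^[m] (u1W β) v ≤ 1 := fun m =>
    iterate_apply_le_one hw (u1W_le_one hβ) m
  set f := (haarConv (u1W β))^[j] (u1W β) with hf
  set g := (haarConv (u1W β))^[j + 1] (u1W β) with hg
  have hgf : g = haarConv (u1W β) f := by rw [hg, hf, Function.iterate_succ']; rfl
  -- the three moments as `∫ (K φ)·ψ`
  have h2 : (haarConv (u1W β))^[2 * j + 2] (u1W β) 1 = ∫⁻ v, haarConv (u1W β) f v * f v ∂μ := by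
    rw [show 2 * j + 2 = (j + (j + 1)) + 1 by ring, iterate_succ_apply_one, Function.iterate_add_apply,
      lintegral_iterate_mul hw hws (hK _) hw j, ← hg, hgf]
  have h3 : (haarConv (u1W β))^[2 * j + 3] (u1W β) 1 = ∫⁻ v, haarConv (u1W β) f v * g v ∂μ := by
    rw [show 2 * j + 3 = ((j + 1) + (j + 1)) + 1 by ring, iterate_succ_apply_one,
      Function.iterate_add_apply, lintegral_iterate_mul hw hws (hK _) hw (j + 1), ← hg, hgf]
  have h4 : (haarConv (u1W β))^[2 * j + 4] (u1W β) 1 = ∫⁻ v, haarConv (u1W β) g v * g v ∂μ := by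
    rw [show 2 * j + 4 = ((j + 1) + (j + 2)) + 1 by ring, iterate_succ_apply_one,
      Function.iterate_add_apply, lintegral_iterate_mul hw hws (hK _) hw (j + 1), ← hg,
      show (haarConv (u1W β))^[j + 2] (u1W β) = haarConv (u1W β) g by
        rw [hg, Function.iterate_succ']; rfl]
  have hfm : Measurable f := hK j
  have hgm : Measurable g := hK (j + 1)
  rw [h2, h3, h4, lintegral_haarConv_mul_eq_form β hfm hfm (hK1 j) (hK1 j),
    lintegral_haarConv_mul_eq_form β hfm hgm (hK1 j) (hK1 (j + 1)),
    lintegral_haarConv_mul_eq_form β hgm hgm (hK1 (j + 1)) (hK1 (j + 1))]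
  -- real side: Cauchy–Schwarz for `B` with `F = f.toReal`, `G = g.toReal`
  set F : Circle → ℝ := fun v => (f v).toReal
  set G : Circle → ℝ := fun v => (g v).toReal
  have hFm : Measurable F := hfm.ennreal_toReal
  have hGm : Measurable G := hgm.ennreal_toReal
  have hF0 : ∀ v, 0 ≤ F v := fun v => ENNReal.toReal_nonneg
  have hG0 : ∀ v, 0 ≤ G v := fun v => ENNReal.toReal_nonneg
  have hFb : ∀ v, |F v| ≤ 1 := fun v => by
    rw [abs_of_nonneg (hF0 v)]
    exact ENNReal.toReal_le_of_le_ofReal zero_le_one (by rw [ENNReal.ofReal_one]; exact hK1 j v)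
  have hGb : ∀ v, |G v| ≤ 1 := fun v => by
    rw [abs_of_nonneg (hG0 v)]
    exact ENNReal.toReal_le_of_le_ofReal zero_le_one (by rw [ENNReal.ofReal_one]; exact hK1 (j + 1) v)
  have hGpos : 0 < ∫ v, G v ∂μ := by
    have hGi : Integrable G μ := Integrable.mono' (integrable_const 1) hGm.aestronglyMeasurable
      (ae_of_all _ fun v => by rw [Real.norm_eq_abs]; exact hGb v)
    rw [integral_pos_iff_support_of_nonneg hG0 hGi]
    have : Function.support G = Set.univ := Set.eq_univ_of_forall fun v =>
      (ENNReal.toReal_pos (iterate_apply_ne_zero hw (u1W_ne_zero β) (j + 1) v)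
        (ne_top_of_le_ne_top ENNReal.one_ne_top (hK1 (j + 1) v))).ne'
    rw [this, measure_univ]; exact one_pos
  have hCS := vonMises_form_cauchySchwarz hβ G F hGm hFm hG0 hF0 hGb hFb hGpos
  -- assemble
  have hnn : ∀ {a b : Circle → ℝ}, (∀ v, 0 ≤ a v) → (∀ v, 0 ≤ b v) →
      0 ≤ ∫ p : Circle × Circle, a p.1 * b p.2 * Real.exp (β * ((p.1⁻¹ * p.2 : Circle) : ℂ).re)
        ∂(μ.prod μ) := fun ha hb =>
    integral_nonneg fun p => mul_nonneg (mul_nonneg (ha _) (hb _)) (Real.exp_pos _).le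
  rw [← ENNReal.ofReal_pow (mul_nonneg (Real.exp_pos _).le (hnn hG0 hF0)),
    ← ENNReal.ofReal_mul (mul_nonneg (Real.exp_pos _).le (hnn hF0 hF0))]
  refine ENNReal.ofReal_le_ofReal ?_
  change (Real.exp (-β) * ∫ p : Circle × Circle, G p.1 * F p.2 *
      Real.exp (β * ((p.1⁻¹ * p.2 : Circle) : ℂ).re) ∂(μ.prod μ)) ^ 2 ≤
    (Real.exp (-β) * ∫ p : Circle × Circle, F p.1 * F p.2 *
      Real.exp (β * ((p.1⁻¹ * p.2 : Circle) : ℂ).re) ∂(μ.prod μ)) *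
    (Real.exp (-β) * ∫ p : Circle × Circle, G p.1 * G p.2 *
      Real.exp (β * ((p.1⁻¹ * p.2 : Circle) : ℂ).re) ∂(μ.prod μ))
  have h := mul_le_mul_of_nonneg_left hCS (sq_nonneg (Real.exp (-β)))
  calc _ = Real.exp (-β) ^ 2 * (∫ p : Circle × Circle, G p.1 * F p.2 *
        Real.exp (β * ((p.1⁻¹ * p.2 : Circle) : ℂ).re) ∂(μ.prod μ)) ^ 2 := by ring
    _ ≤ Real.exp (-β) ^ 2 * ((∫ p : Circle × Circle, G p.1 * G p.2 *
        Real.exp (β * ((p.1⁻¹ * p.2 : Circle) : ℂ).re) ∂(μ.prod μ)) *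
        ∫ p : Circle × Circle, F p.1 * F p.2 *
        Real.exp (β * ((p.1⁻¹ * p.2 : Circle) : ℂ).re) ∂(μ.prod μ)) := h
    _ = _ := by ring

/-- **LOG-CONVEXITY OF THE CONVOLUTION-POWER MOMENTS AT EVERY STEP** (`β ≥ 0`, from the first
index on): `A_{i+2}² ≤ A_{i+1}·A_{i+3}` for every `i`, `A_i = (K_wⁱ w_β)(1)`. [ours] -/
theorem u1_iterate_logConvex (hβ : 0 ≤ β) (i : ℕ) :
    ((haarConv (u1W β))^[i + 2] (u1W β) 1) ^ 2 ≤
      (haarConv (u1W β))^[i + 1] (u1W β) 1 * (haarConv (u1W β))^[i + 3] (u1W β) 1 := by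
  rcases Nat.even_or_odd i with ⟨j, rfl⟩ | ⟨j, rfl⟩
  · have h := u1_iterate_logConvex_odd β j
    rw [show j + j + 2 = 2 * j + 2 by ring, show j + j + 1 = 2 * j + 1 by ring,
      show j + j + 3 = 2 * j + 3 by ring]
    exact h
  · have h := u1_iterate_logConvex_even hβ j
    rw [show 2 * j + 1 + 2 = 2 * j + 3 by ring, show 2 * j + 1 + 1 = 2 * j + 2 by ring,
      show 2 * j + 1 + 3 = 2 * j + 4 by ring]
    exact h

end Summit.Ventures.LatticeQCDFlow.Theory2.HaarConv

end
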